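import Mathlib
import HarnessLib
import Summits.CriticalPhenomena.PercolationContinuityZ3.Theses.PercShatteringRace

/-!
# Sketch — crux-ideate stmt-CriticalPhenomena-5786 (FreeSusceptibilityPowerSaving = S(1/2)), ideator 1

First lemmas of the two idea cards, stated over existing declarations (no proofs required at
this stage; they must elaborate).

* Card A `bk-hyperscaling-tail-transfer`: Hutchcroft's BK hyperscaling inequality
  (arXiv:2008.11197 Thm 2.1) on the finite free-box graph `Λ_R` turns an in-box VOLUME-TAIL bound
  `W(θ, κ)` into the crux whenever `θ (11 - 4κ) ≥ 1`, `θ ≤ 1/2`.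
* Card B `two-ghost-at-distance-bootstrap`: a two-ghost inequality for PAIRS at distance `ℓ`
  with polynomial loss `ℓ^{x₂}`, `x₂ ≤ 7/8`, fed into Hutchcroft's bootstrap, gives the bulk
  volume tail `P_{p_c}(|C| ≥ n) ≤ A n^{-1/11}`, which is `W(1/11, 0)`.
-/

namespace Summit.CriticalPhenomena.PercolationContinuityZ3.Cruxes.FreeSusceptibilityPowerSaving.Sketch

open scoped Classical
open Literature.Probability.Percolation Literature.Probability.LatticeModels

/-- Critical bond percolation measure on `ℤ³`. -/
noncomputable abbrev μc : MeasureTheory.Measure (BondConfig (Site 3)) :=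
  bondPercolation (zdGraph 3) (criticalProbI 3)

/-- `|C_{Λ_R}(u)|`: the number of sites of `Λ_R = box 3 R` joined to `u` by an open path inside
`Λ_R` (free-boundary / in-box cluster size). -/
noncomputable def inBoxSize (R : ℕ) (u : Site 3) (ω : BondConfig (Site 3)) : ℕ :=
  ((box 3 R).filter fun v => ω ∈ openConnIn (↑(box 3 R)) u v).card

/-- Sup-norm `‖x‖_∞` of a site of `ℤ³`, as a natural number. -/
def supNorm (x : Site 3) : ℕ := (Finset.univ : Finset (Fin 3)).sup fun i => (x i).natAbs

/-- `W(θ, κ)`: in-box volume tail, uniformly over roots, with an `R^κ` threshold: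
`P_{p_c}(|C_{Λ_R}(u)| ≥ λ) ≤ A (R^κ / λ)^θ` for all `R ≥ 1`, `u ∈ Λ_R`, `λ ≥ 1`. -/
def InBoxVolumeTail (θ κ : ℝ) : Prop :=
  ∃ A : ℝ, ∀ R : ℕ, 1 ≤ R → ∀ u ∈ box 3 R, ∀ lam : ℝ, 1 ≤ lam →
    μc.real {ω | lam ≤ (inBoxSize R u ω : ℝ)} ≤ A * (((R : ℝ) ^ κ / lam) ^ θ)

/-- NAMED FACT to vendor (Hutchcroft, PTRF 181 (2021), arXiv:2008.11197, Thm 2.1, specialised to the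
finite graph `Λ_R ⊂ ℤ³` with `Λ = V(Λ_R)`): a universal `C` such that a root-uniform in-box volume
tail with exponent `θ ∈ [0, 1/2]` and constant `A ≥ 1` bounds the root-averaged in-box two-point
function by `C A^{2/(1+θ)} |Λ_R|^{-2θ/(1+θ)}`, for EVERY root `u` (in particular the centre). -/
def HutchcroftHyperscalingFreeBox : Prop :=
  ∃ C : ℝ, ∀ θ A : ℝ, 0 ≤ θ → θ ≤ 1 / 2 → 1 ≤ A → ∀ R : ℕ, 1 ≤ R →
    (∀ u ∈ box 3 R, ∀ lam : ℝ, 0 < lam → μc.real {ω | lam ≤ (inBoxSize R u ω : ℝ)} ≤ A * lam ^ (-θ)) →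
    ∀ u ∈ box 3 R,
      (∑ v ∈ box 3 R, μc.real (openConnIn (↑(box 3 R)) u v)) / ((box 3 R).card : ℝ)
        ≤ C * A ^ (2 / (1 + θ)) * ((box 3 R).card : ℝ) ^ (-(2 * θ / (1 + θ)))

/-- CARD A, first lemma (provable from `HutchcroftHyperscalingFreeBox` + `card_box` arithmetic):
every admissible member of the family `W(θ, κ)` implies the crux `S(1/2)`.
Admissible: `0 < θ ≤ 1/2`, `0 ≤ κ`, `θ (11 - 4κ) ≥ 1` (e.g. `(1/11,0)`, `(1/5,3/2)`, `(1/3,2)`, `(1/2,9/4)`). -/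
def FirstLemmaA : Prop :=
  HutchcroftHyperscalingFreeBox →
    ∀ θ κ : ℝ, 0 < θ → θ ≤ 1 / 2 → 0 ≤ κ → 1 ≤ θ * (11 - 4 * κ) →
      InBoxVolumeTail θ κ →
        Summit.CriticalPhenomena.PercolationContinuityZ3.Theses.PercShatteringRace.FreeSusceptibilityPowerSaving

/-- `TG(x₂)`, two-ghost at distance: for `p < p_c`, the probability that `0` and `x` lie in
DISTINCT open clusters each with at least `n` vertices is `≤ C ‖x‖_∞^{x₂} n^{-1/2}`, uniformly in
`p < p_c(ℤ³)`, `x ≠ 0`, `n ≥ 1` (at `‖x‖ = 1` this is Hutchcroft's two-ghost inequality,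
arXiv:1808.08940 Cor. 1.7, up to vertices-vs-edges counting). -/
def TwoGhostAtDistance (x₂ : ℝ) : Prop :=
  ∃ C : ℝ, ∀ p : unitInterval, p < criticalProbI 3 → ∀ x : Site 3, x ≠ 0 → ∀ n : ℕ, 1 ≤ n →
    (bondPercolation (zdGraph 3) p).real
        {ω | ¬ (openGraph ω).Reachable 0 x ∧ (n : ℕ∞) ≤ (openCluster ω 0).encard
              ∧ (n : ℕ∞) ≤ (openCluster ω x).encard}
      ≤ C * (supNorm x : ℝ) ^ x₂ * (n : ℝ) ^ (-(1 / 2 : ℝ))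

/-- Bulk critical volume tail with exponent `θ`: `P_{p_c}(|C(0)| ≥ n) ≤ A n^{-θ}` (clusters counted in
`ℕ∞`, so an infinite cluster counts as `≥ n`; in particular this implies `θ(p_c) = 0`). -/
def BulkVolumeTail (θ : ℝ) : Prop :=
  ∃ A : ℝ, ∀ n : ℕ, 1 ≤ n → μc.real {ω | (n : ℕ∞) ≤ (openCluster ω 0).encard} ≤ A * (n : ℝ) ^ (-θ)

/-- CARD B, first lemma (Hutchcroft's bootstrap run verbatim on `ℤ³`: FKG + BK hyperscaling
Thm 2.1 + continuity in `p`): two-ghost at distance with `x₂ ≤ 7/8` gives `δ ≤ 11`, i.e. the bulk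
volume tail with exponent `1/11` — the closure condition is `θ ≤ (3 - 2x₂)/(2x₂ + 12)`. -/
def FirstLemmaB : Prop :=
  ∀ x₂ : ℝ, 0 ≤ x₂ → x₂ ≤ 7 / 8 → TwoGhostAtDistance x₂ → BulkVolumeTail (1 / 11)

/-- Card B, second step = Card A at `(θ, κ) = (1/11, 0)`: the bulk tail dominates the in-box tail
(`|C_{Λ_R}(u)| ≤ |C(u)|`, translation invariance), so `BulkVolumeTail (1/11) → InBoxVolumeTail (1/11) 0`. -/
def BulkToInBox : Prop := BulkVolumeTail (1 / 11) → InBoxVolumeTail (1 / 11) 0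

/-- Sanity: the exchange rate of Card A at the four named members. -/
example : (1 : ℝ) ≤ (1 / 11) * (11 - 4 * 0) ∧ (1 : ℝ) ≤ (1 / 5) * (11 - 4 * (3 / 2))
    ∧ (1 : ℝ) ≤ (1 / 3) * (11 - 4 * 2) ∧ (1 : ℝ) ≤ (1 / 2) * (11 - 4 * (9 / 4)) := by norm_num

/-- Sanity: the bootstrap closure `θ = (3 - 2x₂)/(2x₂ + 12)` at `x₂ = 7/8` is exactly `1/11`. -/
example : (3 - 2 * (7 / 8 : ℝ)) / (2 * (7 / 8) + 12) = 1 / 11 := by norm_num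

end Summit.CriticalPhenomena.PercolationContinuityZ3.Cruxes.FreeSusceptibilityPowerSaving.Sketch
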